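import Literature.AlgebraicGeometry.Motives.FlatFamilyCutOutByDegreeEquations
import Literature.AlgebraicGeometry.Modules.KilledByLocal
import Literature.AlgebraicGeometry.Modules.PullbackQuasicoherent
import Literature.AlgebraicGeometry.Morphisms.ProjectiveSpaceOverBasePoints
import HarnessLib

/-!
# If the sub-family lies in the fixed closed `W` after base change, the restricted forms `α_m` die after base change
# (II-b (b1) FILE 2A-β, direction «containment ⇒ equations»)

Layer `Literature/AlgebraicGeometry/Motives`, namespace `Literature.AlgebraicGeometry.Motives`.  THEOREMS ONLY (no `def`, no instance, no
notation, no named fact, no `sorry`); universe `0` (the universe of ★ PART B `Motives/FlatFamilyCutOutByDegreeEquations`).  Cell `hodgecm-mathlib`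
(D-0151 ∕ FLOOR 0), P1 sub-line F-4 layer 2, sub-stub (II-b) «the Hom-scheme», brick (b1) «sub-families inside a fixed closed `W ⊂ 𝐏(ι; T)` form a
closed sub-functor», FILE 2A-β (B-p20 (g14) blueprint `BLUEPRINT-F4-IIb-b1-FILE2A` §2; author B-p20 (g15)).  Count-neutral capital
(`--supports stmt-HodgeConjecture-24835`); HC_CM is proved only modulo the 7 printed citations until rung 0 closes, and nothing here bears on it.

## The source, as printed

[Kollar1996] I Thm. 1.10 (proof) and [MumfordFogartyKirwan1994] Ch. 0 §5 (c) (p. 23): `Hilb(W/S) ⊂ Hilb(ℙ/S)` is the closed subscheme where the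
equations of `W`, restricted to the universal family, vanish.  The sheaf-theoretic content of the easy half: if `Z_{T′} ⊂ W_{T′}`, a degree-`m` form
vanishing on `W` vanishes on `Z_{T′}`; by cohomology and base change for `(p_Z)_* 𝒪_Z(m)` ([Mumford1966CurvesSurface] Lecture 15 (II.), [Hartshorne1977]
III Prop. 9.3 (p. 255) and II Prop. 5.12 (c) (p. 117)) this says that the restriction map `α_m : K_W(m) → (p_Z)_* 𝒪_Z(m)` dies after `b^*`.

## Setting

`T` a scheme, `𝐏(ι; T) = T × 𝐏ⁿ_ℤ` (★ `Morphisms.projectiveSpace`, `n = Nat.card ι`, `πT`, `ιP = pullback.snd`), TWO closed families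
`i : Z ⟶ 𝐏(ι; T)`, `iW : W ⟶ 𝐏(ι; T)` with their monomial maps `ψ_{Z,m}`, `ψ_{W,m} : 𝒪_T^{(Mon_m)} ⟶ (p_?)_* 𝒪_?(m)` (binders with the letter `hψ` of
★ PART B), `K_W(m) := kernel ψ_{W,m}` and **`α_m := kernel.ι ψ_{W,m} ≫ ψ_{Z,m}`** (★-to-be `Motives/SubfamilyContainedInClosedIdeal`).

## Statements

* §1 `baseChange_app_unitSectionLE_freeSectionOn_of_sq`, `baseChange_app_sum_smul_unitSectionLE_of_sq` — ★ PART A §3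
  (`Motives/FlatFamilyDegreeFormsDictionary.baseChange_app_sum_smul_unitSectionLE`) for a square that merely COMMUTES (`g ≫ p = q ≫ x`), same proof:
  the base-change composite sends `Σ_w c_w • η_x(ε_w|_V)|_U` to `Σ_w q♯(c_w) • μ_w|_{q⁻¹U}`.
* §2 **`pullback_map_restrictForms_eq_zero_of_ker_comap_le`** — for `b : T′ → T` (ANY `T′`) with `𝓘_{W_{T′}} ≤ 𝓘_{Z_{T′}}` on `𝐏(ι; T′)`
  (`iW.ker.comap 𝐏(b) ≤ i.ker.comap 𝐏(b)`) and the base-change morphism of `(p_Z)_* 𝒪_Z(m)` an isomorphism (binder `hbc`, the output of ★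
  `Modules/ProjectiveFamilyTwistPushforward.isIso_pushforwardBaseChangeHom_twistMod_of_forall_fieldPoint`): **`b^* α_m = 0`**.  Road: `Z′ := Z ×_{𝐏(ι;T)} 𝐏(ι;T′)`,
  `W′`, the factorisation `j : Z′ → W′` (Mathlib `IsClosedImmersion.lift`, ★ `ker_eq_comap_ker_of_isPullback`); over an affine `U ⊆ b⁻¹V` the sections of
  `b^* K_W(m)` are generated by the `η_b(s)` (★ `isBaseChange_unitSectionLE`); for such `s = Σ_w c_w ε_w` both `η_b(ψ_Z(s))` (through the ISOMORPHISM
  `b^*(p_Z)_*𝒪_Z(m) ≅ (p_{Z′})_*𝒪_{Z′}(m)`) and `η_b(ψ_W(s)) = 0` (through the base-change map of the commuting square `Z′ → W′ → W`) go to the same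
  combination `Σ_w c_w • μ_w|_{Z′}` of monomial sections of `𝒪_{Z′}(m)` (§1); conclude with ★ `Modules/KilledByLocal.eq_zero_of_app_eq_zero_of_iSup_eq_top`.

## References
* [Kollar1996] J. Kollár, *Rational Curves on Algebraic Varieties* (1996), I Thm. 1.10 (proof).
* [MumfordFogartyKirwan1994] D. Mumford, J. Fogarty, F. Kirwan, *Geometric Invariant Theory*, 3rd ed. (1994), Ch. 0 §5 (c) (p. 23).
* [Mumford1966CurvesSurface] D. Mumford, *Lectures on Curves on an Algebraic Surface* (1966), Lecture 15 (II.) (p. 106), (IV.)–(V.) (pp. 107–108).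
* [Hartshorne1977] R. Hartshorne, *Algebraic Geometry* (1977), II Prop. 5.12 (c) (p. 117), II §5 (p. 110), III Prop. 9.3 (p. 255), II Ex. 3.11 (a) (p. 92).
* [GortzWedhorn2020] U. Görtz, T. Wedhorn, *Algebraic Geometry I*, 2nd ed. (2020), Prop. 4.20 (p. 104), Prop. 7.24 (2).
-/

noncomputable section

-- `TopCat.Presheaf`/`Scheme.Modules` are not reducible (as in Mathlib's `AlgebraicGeometry/Modules/Sheaf.lean`).
set_option backward.isDefEq.respectTransparency false

open CategoryTheory CategoryTheory.Limits CategoryTheory.Abelian AlgebraicGeometry TopologicalSpace Opposite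
open Literature.AlgebraicGeometry.Morphisms Literature.AlgebraicGeometry.Morphisms.ProjCech
open Literature.AlgebraicGeometry.Modules Literature.AlgebraicGeometry.Modules.SerreTwist

namespace Literature.AlgebraicGeometry.Motives

/-! ### §1 Base change of a monomial map along a COMMUTING square -/

section Square

variable {A A₀ : Type} [CommRing A] [CommRing A₀] {r : ℕ} {T Y Y₀ S₀ : Scheme.{0}} {p : Y ⟶ T} (ιY : Y ⟶ PP A r)
  (ι₀ : Y₀ ⟶ PP A₀ r) {g : Y₀ ⟶ Y} {q : Y₀ ⟶ S₀} {x : S₀ ⟶ T} (hw : g ≫ p = q ≫ x) (d : ℕ)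
  (χ : freeModule T (Fin d → Fin (r + 1)) ⟶ (Scheme.Modules.pushforward p).obj (twistMod ιY (unitModule Y) d))
  (hχ : ∀ (w : Fin d → Fin (r + 1)) (V : T.Opens), χ.app V (freeSectionOn T w V) =
    ((Scheme.Modules.pushforward p).obj (twistMod ιY (unitModule Y) d)).presheaf.map (homOfLE (le_top : V ≤ ⊤)).op
      (show Γ((Scheme.Modules.pushforward p).obj (twistMod ιY (unitModule Y) d), ⊤) from monomialSection ιY d w))

include hχ in
/-- **Base change of a monomial map along a commuting square, on the pulled-back basis sections** (★ PART A §3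
`baseChange_app_unitSectionLE_freeSectionOn` with the cartesian hypothesis weakened to `g ≫ p = q ≫ x`; same proof): for
`χ : 𝒪_T^{(J)} ⟶ p_* 𝒪_Y(d)` sending `ε_w` to `μ_w`, a commuting square `g : Y₀ ⟶ Y`, `q : Y₀ ⟶ S₀` over `x : S₀ ⟶ T`, and a transport
`Φ : 𝒪_{Y₀}(d) ≅ 𝒪_{Y₀}(d)'` from the twist along `g ≫ ιY` to the twist along `ι₀ : Y₀ ⟶ 𝐏ʳ_{A₀}` taking monomials to monomials, the composite of `x^*χ`,
the base-change morphism `x^* p_* ⟶ q_* g^*` (★ `Modules/PushforwardBaseChangeHom`), `q_*` of `g^* 𝒪_Y(d) ≅ 𝒪_{Y₀}(d)` (★ `Modules/SerreTwistModBaseChange`)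
and `q_* Φ` sends `η_x(ε_w|_V)|_U` to `μ_w|_{q⁻¹U}`. [cite: Hartshorne1977, II Prop. 5.12 (c) (p. 117)] [cite: Hartshorne1977, III Prop. 9.3 (p. 255)] -/
theorem baseChange_app_unitSectionLE_freeSectionOn_of_sq (Φ : twistMod (g ≫ ιY) (unitModule Y₀) d ≅ twistMod ι₀ (unitModule Y₀) d)
    (hΦ : ∀ w : Fin d → Fin (r + 1), Φ.hom.app ⊤ (monomialSection (g ≫ ιY) d w) = monomialSection ι₀ d w)
    {V : T.Opens} {U : S₀.Opens} (hU : U ≤ x ⁻¹ᵁ V) (w : Fin d → Fin (r + 1)) :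
    ((Scheme.Modules.pullback x).map χ ≫ pushforwardBaseChangeHom hw (twistMod ιY (unitModule Y) d) ≫
        (Scheme.Modules.pushforward q).map (pullbackTwistHom g ιY d ≫ Φ.hom)).app U
      (unitSectionLE x (freeModule T (Fin d → Fin (r + 1))) hU (freeSectionOn T w V)) =
    (show Γ((Scheme.Modules.pushforward q).obj (twistMod ι₀ (unitModule Y₀) d), U) from
      (twistMod ι₀ (unitModule Y₀) d).presheaf.map (homOfLE (le_top : q ⁻¹ᵁ U ≤ ⊤)).op (monomialSection ι₀ d w)) := by
  rw [Scheme.Modules.Hom.comp_app, Scheme.Modules.Hom.comp_app, CategoryTheory.comp_apply, CategoryTheory.comp_apply,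
    pullback_map_app_unitSectionLE, hχ]
  change (pullbackTwistHom g ιY d ≫ Φ.hom).app (q ⁻¹ᵁ U) ((pushforwardBaseChangeHom hw (twistMod ιY (unitModule Y) d)).app U
    (unitSectionLE x ((Scheme.Modules.pushforward p).obj (twistMod ιY (unitModule Y) d)) hU
      (show Γ((Scheme.Modules.pushforward p).obj (twistMod ιY (unitModule Y) d), V) from
        ((twistMod ιY (unitModule Y) d).presheaf.map (homOfLE (p.preimage_mono (le_top : V ≤ ⊤))).op (monomialSection ιY d w) :
          Γ(twistMod ιY (unitModule Y) d, p ⁻¹ᵁ V))))) =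
    (twistMod ι₀ (unitModule Y₀) d).presheaf.map (homOfLE (le_top : q ⁻¹ᵁ U ≤ ⊤)).op (monomialSection ι₀ d w)
  rw [pushforwardBaseChangeHom_app_unitSectionLE,
    unitSectionLE_map_of_le (twistMod ιY (unitModule Y) d) (le_top : (⊤ : Y₀.Opens) ≤ g ⁻¹ᵁ ⊤) _
      (p.preimage_mono (le_top : V ≤ ⊤)) (le_top : q ⁻¹ᵁ U ≤ ⊤) (monomialSection ιY d w),
    Scheme.Modules.Hom.app_map_apply, Scheme.Modules.Hom.comp_app, CategoryTheory.comp_apply,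
    pullbackTwistHom_app_unitSectionLE_monomialSection, hΦ]

include hχ in
/-- The same on a `Γ(S₀, U)`-combination of the pulled-back basis sections, for a COMMUTING square:
`Σ_w c_w • η_x(ε_w|_V)|_U ↦ Σ_w q♯(c_w) • μ_w|_{q⁻¹U}` (★ PART A §3 `baseChange_app_sum_smul_unitSectionLE`, cartesian hypothesis weakened).
[cite: Hartshorne1977, II Prop. 5.12 (c) (p. 117)] [cite: Hartshorne1977, III Prop. 9.3 (p. 255)] -/
theorem baseChange_app_sum_smul_unitSectionLE_of_sq (Φ : twistMod (g ≫ ιY) (unitModule Y₀) d ≅ twistMod ι₀ (unitModule Y₀) d)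
    (hΦ : ∀ w : Fin d → Fin (r + 1), Φ.hom.app ⊤ (monomialSection (g ≫ ιY) d w) = monomialSection ι₀ d w)
    {V : T.Opens} {U : S₀.Opens} (hU : U ≤ x ⁻¹ᵁ V) (c : (Fin d → Fin (r + 1)) → Γ(S₀, U)) :
    ((Scheme.Modules.pullback x).map χ ≫ pushforwardBaseChangeHom hw (twistMod ιY (unitModule Y) d) ≫
        (Scheme.Modules.pushforward q).map (pullbackTwistHom g ιY d ≫ Φ.hom)).app U
      (∑ w, c w • unitSectionLE x (freeModule T (Fin d → Fin (r + 1))) hU (freeSectionOn T w V)) =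
    (show Γ((Scheme.Modules.pushforward q).obj (twistMod ι₀ (unitModule Y₀) d), U) from
      ∑ w, q.app U (c w) • (twistMod ι₀ (unitModule Y₀) d).presheaf.map (homOfLE (le_top : q ⁻¹ᵁ U ≤ ⊤)).op
        (monomialSection ι₀ d w)) := by
  rw [map_sum]
  refine Finset.sum_congr rfl fun w _ => ?_
  rw [Scheme.Modules.Hom.app_smul, baseChange_app_unitSectionLE_freeSectionOn_of_sq ιY ι₀ hw d χ hχ Φ hΦ hU w]
  rfl

end Square

/-! ### §2 Containment after base change kills the restricted forms after base change -/

section Vanish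

variable {ι : Type} {T Z W : Scheme.{0}} [IsLocallyNoetherian T] (i : Z ⟶ Morphisms.projectiveSpace ι T) [IsClosedImmersion i]
  (iW : W ⟶ Morphisms.projectiveSpace ι T) [IsClosedImmersion iW] (m : ℕ)
  (ψZ : freeModule T (Fin m → Fin (Nat.card ι + 1)) ⟶ (Scheme.Modules.pushforward (i ≫ Morphisms.projectiveSpaceFst ι T)).obj
    (twistMod (i ≫ pullback.snd (terminal.from T) (terminal.from (Morphisms.projectiveSpaceInt ι))) (unitModule Z) m))
  (hψZ : ∀ (w : Fin m → Fin (Nat.card ι + 1)) (V : T.Opens), ψZ.app V (freeSectionOn T w V) =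
    ((Scheme.Modules.pushforward (i ≫ Morphisms.projectiveSpaceFst ι T)).obj
      (twistMod (i ≫ pullback.snd (terminal.from T) (terminal.from (Morphisms.projectiveSpaceInt ι))) (unitModule Z) m)).presheaf.map
      (homOfLE (le_top : V ≤ ⊤)).op
      (show Γ((Scheme.Modules.pushforward (i ≫ Morphisms.projectiveSpaceFst ι T)).obj
        (twistMod (i ≫ pullback.snd (terminal.from T) (terminal.from (Morphisms.projectiveSpaceInt ι))) (unitModule Z) m), ⊤) from
        monomialSection (i ≫ pullback.snd (terminal.from T) (terminal.from (Morphisms.projectiveSpaceInt ι))) m w))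
  (ψW : freeModule T (Fin m → Fin (Nat.card ι + 1)) ⟶ (Scheme.Modules.pushforward (iW ≫ Morphisms.projectiveSpaceFst ι T)).obj
    (twistMod (iW ≫ pullback.snd (terminal.from T) (terminal.from (Morphisms.projectiveSpaceInt ι))) (unitModule W) m))
  (hψW : ∀ (w : Fin m → Fin (Nat.card ι + 1)) (V : T.Opens), ψW.app V (freeSectionOn T w V) =
    ((Scheme.Modules.pushforward (iW ≫ Morphisms.projectiveSpaceFst ι T)).obj
      (twistMod (iW ≫ pullback.snd (terminal.from T) (terminal.from (Morphisms.projectiveSpaceInt ι))) (unitModule W) m)).presheaf.map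
      (homOfLE (le_top : V ≤ ⊤)).op
      (show Γ((Scheme.Modules.pushforward (iW ≫ Morphisms.projectiveSpaceFst ι T)).obj
        (twistMod (iW ≫ pullback.snd (terminal.from T) (terminal.from (Morphisms.projectiveSpaceInt ι))) (unitModule W) m), ⊤) from
        monomialSection (iW ≫ pullback.snd (terminal.from T) (terminal.from (Morphisms.projectiveSpaceInt ι))) m w))

omit [IsLocallyNoetherian T] in
/-- The components of an isomorphism of `𝒪_X`-modules are injective. [cite: Hartshorne1977, II §5 (p. 110)] -/
theorem app_injective_of_isIso {X : Scheme.{0}} {M N : X.Modules} (φ : M ⟶ N) [IsIso φ] (U : X.Opens) :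
    Function.Injective (φ.app U) := by
  haveI : IsIso (φ.app U) := Scheme.Modules.Hom.isIso_iff_isIso_app.mp inferInstance U
  exact (ConcreteCategory.bijective_of_isIso (φ.app U)).1

omit [IsLocallyNoetherian T] in
/-- The affine opens `U ⊆ T′` lying over some affine open `V ⊆ T` (`U ≤ b⁻¹V`) cover `T′` (affine opens form a basis of the topology on both
sides). [cite: Hartshorne1977, II Prop. 5.12 (c) (p. 117)] -/
theorem iSup_affineOpens_le_preimage_eq_top {T' : Scheme.{0}} (b : T' ⟶ T) :
    ⨆ k : {p : T.affineOpens × T'.affineOpens // (p.2 : T'.Opens) ≤ b ⁻¹ᵁ (p.1 : T.Opens)}, ((k.1.2 : T'.affineOpens) : T'.Opens) = ⊤ := by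
  refine top_le_iff.mp fun t _ => ?_
  obtain ⟨V, hV, hbt, -⟩ := (Opens.isBasis_iff_nbhd.mp T.isBasis_affineOpens) (show b.base t ∈ (⊤ : T.Opens) from trivial)
  obtain ⟨U, hU, htU, hUV⟩ := (Opens.isBasis_iff_nbhd.mp T'.isBasis_affineOpens) (show t ∈ b ⁻¹ᵁ V from hbt)
  exact Opens.mem_iSup.mpr ⟨⟨(⟨V, hV⟩, ⟨U, hU⟩), hUV⟩, htU⟩

include hψZ hψW in
/-- **Containment after base change kills the restricted forms after base change.**  Let `Z, W ⊂ 𝐏(ι; T)` be closed with monomial maps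
`ψ_{Z,m}`, `ψ_{W,m}`, let `b : T′ → T` be ANY morphism such that the base-change morphism `b^*(p_Z)_* 𝒪_Z(m) ⟶ (p_{Z_{T′}})_* 𝒪_{Z_{T′}}(m)` is an
isomorphism for every cartesian square over `b` (binder `hbc` — cohomology and base change, e.g. from flatness and `H¹ = 0` on the fibres), and suppose
`Z_{T′} ⊂ W_{T′}` as closed subschemes of `𝐏(ι; T′)`, i.e. `𝓘_W · 𝒪_{𝐏(ι;T′)} ≤ 𝓘_Z · 𝒪_{𝐏(ι;T′)}`.  THEN `b^* α_m = 0` for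
`α_m = kernel.ι ψ_{W,m} ≫ ψ_{Z,m}` — the degree-`m` forms vanishing on `W` vanish, after base change, as sections of `b^*(p_Z)_* 𝒪_Z(m)`.
[cite: Kollar1996, I Thm. 1.10 (proof)] [cite: Mumford1966CurvesSurface, Lecture 15 (IV.)–(V.) (pp. 107–108)] [cite: Hartshorne1977, III Prop. 9.3 (p. 255)] -/
theorem pullback_map_restrictForms_eq_zero_of_ker_comap_le {T' : Scheme.{0}} (b : T' ⟶ T)
    (hbc : ∀ ⦃ZT' : Scheme.{0}⦄ ⦃pr : ZT' ⟶ Z⦄ ⦃pT' : ZT' ⟶ T'⦄ (H : IsPullback pr pT' (i ≫ Morphisms.projectiveSpaceFst ι T) b),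
      IsIso (pushforwardBaseChangeHom H.w
        (twistMod (i ≫ pullback.snd (terminal.from T) (terminal.from (Morphisms.projectiveSpaceInt ι))) (unitModule Z) m)))
    (hcont : iW.ker.comap (Morphisms.projectiveSpaceMap ι b) ≤ i.ker.comap (Morphisms.projectiveSpaceMap ι b)) :
    (Scheme.Modules.pullback b).map (kernel.ι ψW ≫ ψZ) = 0 := by
  classical
  -- the base changes `Z' = Z ×_{𝐏(ι;T)} 𝐏(ι;T')`, `W'`, over `T'`
  have S1 : IsPullback (pullback.fst i (Morphisms.projectiveSpaceMap ι b)) (pullback.snd i (Morphisms.projectiveSpaceMap ι b)) i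
      (Morphisms.projectiveSpaceMap ι b) := IsPullback.of_hasPullback _ _
  have S1W : IsPullback (pullback.fst iW (Morphisms.projectiveSpaceMap ι b)) (pullback.snd iW (Morphisms.projectiveSpaceMap ι b)) iW
      (Morphisms.projectiveSpaceMap ι b) := IsPullback.of_hasPullback _ _
  have S2 := Morphisms.isPullback_projectiveSpaceMap ι b
  have HZ : IsPullback (pullback.fst i (Morphisms.projectiveSpaceMap ι b))
      (pullback.snd i (Morphisms.projectiveSpaceMap ι b) ≫ Morphisms.projectiveSpaceFst ι T')
      (i ≫ Morphisms.projectiveSpaceFst ι T) b := S1.paste_vert S2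
  -- the factorisation `j : Z' ⟶ W'` through the closed immersion `W' ↪ 𝐏(ι; T')`
  have hker : (pullback.snd iW (Morphisms.projectiveSpaceMap ι b)).ker ≤ (pullback.snd i (Morphisms.projectiveSpaceMap ι b)).ker := by
    rw [ker_eq_comap_ker_of_isPullback S1W.flip, ker_eq_comap_ker_of_isPullback S1.flip]
    exact hcont
  obtain ⟨j, hj⟩ : ∃ j : pullback i (Morphisms.projectiveSpaceMap ι b) ⟶ pullback iW (Morphisms.projectiveSpaceMap ι b),
      j ≫ pullback.snd iW (Morphisms.projectiveSpaceMap ι b) = pullback.snd i (Morphisms.projectiveSpaceMap ι b) :=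
    ⟨IsClosedImmersion.lift _ _ hker, IsClosedImmersion.lift_fac _ _ _⟩
  -- the commuting square `Z' → W' → W` over `b`
  have hwW : (j ≫ pullback.fst iW (Morphisms.projectiveSpaceMap ι b)) ≫ (iW ≫ Morphisms.projectiveSpaceFst ι T) =
      (pullback.snd i (Morphisms.projectiveSpaceMap ι b) ≫ Morphisms.projectiveSpaceFst ι T') ≫ b := by
    rw [Category.assoc, ← Category.assoc (pullback.fst iW _) iW, S1W.w, Category.assoc, Morphisms.projectiveSpaceMap_fst,
      ← Category.assoc, hj, Category.assoc]
  -- the common structure map `ι₀ := j ≫ iW' ≫ ιP' : Z' ⟶ 𝐏ⁿ_ℤ` and the identity transports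
  have hιZ : pullback.fst i (Morphisms.projectiveSpaceMap ι b) ≫
      (i ≫ pullback.snd (terminal.from T) (terminal.from (Morphisms.projectiveSpaceInt ι))) =
      j ≫ pullback.snd iW (Morphisms.projectiveSpaceMap ι b) ≫
        pullback.snd (terminal.from T') (terminal.from (Morphisms.projectiveSpaceInt ι)) := by
    rw [← Category.assoc, S1.w, Category.assoc, Morphisms.projectiveSpaceMap_snd, ← Category.assoc, hj]
  have hιW : (j ≫ pullback.fst iW (Morphisms.projectiveSpaceMap ι b)) ≫
      (iW ≫ pullback.snd (terminal.from T) (terminal.from (Morphisms.projectiveSpaceInt ι))) =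
      j ≫ pullback.snd iW (Morphisms.projectiveSpaceMap ι b) ≫
        pullback.snd (terminal.from T') (terminal.from (Morphisms.projectiveSpaceInt ι)) := by
    rw [Category.assoc, ← Category.assoc (pullback.fst iW _) iW, S1W.w, Category.assoc, Morphisms.projectiveSpaceMap_snd]
  obtain ⟨Φ, hΦ⟩ := exists_twistMod_iso_of_structureMap_eq hιZ m
  obtain ⟨ΦW, hΦW⟩ := exists_twistMod_iso_of_structureMap_eq hιW m
  -- the base-change composite on the `Z`-side is an isomorphism
  haveI := hbc HZ
  haveI := isIso_pullbackTwistHom (pullback.fst i (Morphisms.projectiveSpaceMap ι b))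
    (i ≫ pullback.snd (terminal.from T) (terminal.from (Morphisms.projectiveSpaceInt ι))) m
  have hinj := fun U => app_injective_of_isIso (pushforwardBaseChangeHom HZ.w
      (twistMod (i ≫ pullback.snd (terminal.from T) (terminal.from (Morphisms.projectiveSpaceInt ι))) (unitModule Z) m) ≫
    (Scheme.Modules.pushforward (pullback.snd i (Morphisms.projectiveSpaceMap ι b) ≫ Morphisms.projectiveSpaceFst ι T')).map
      (pullbackTwistHom (pullback.fst i (Morphisms.projectiveSpaceMap ι b))
        (i ≫ pullback.snd (terminal.from T) (terminal.from (Morphisms.projectiveSpaceInt ι))) m ≫ Φ.hom)) U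
  -- test on the sections over the affine opens `U ⊆ b⁻¹V`, `V ⊆ T` affine
  have hK : IsAffineLocalizing (kernel ψW) := isAffineLocalizing_kernel_monomialMap iW m ψW
  refine eq_zero_of_app_eq_zero_of_iSup_eq_top _ (IsAffineLocalizing.pullback b hK)
    (fun k : {p : T.affineOpens × T'.affineOpens // (p.2 : T'.Opens) ≤ b ⁻¹ᵁ (p.1 : T.Opens)} => k.1.2)
    (iSup_affineOpens_le_preimage_eq_top b) fun k s => ?_
  obtain ⟨⟨⟨V, hV⟩, ⟨U, hU⟩⟩, hUV⟩ := k
  change U ≤ b ⁻¹ᵁ V at hUV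
  change Γ((Scheme.Modules.pullback b).obj (kernel ψW), U) at s
  change ((Scheme.Modules.pullback b).map (kernel.ι ψW ≫ ψZ)).app U s = 0
  -- the sections of `b^* K_W(m)` over `U` are generated by the `η_b(s')|_U`, `s' ∈ Γ(V, K_W(m))`
  letI := (b.appLE V U hUV).hom.toAlgebra
  letI : Module Γ(T, V) Γ((Scheme.Modules.pullback b).obj (kernel ψW), U) := Module.compHom _ (b.appLE V U hUV).hom
  haveI : IsScalarTower Γ(T, V) Γ(T', U) Γ((Scheme.Modules.pullback b).obj (kernel ψW), U) :=
    ⟨fun a a' y => mul_smul ((b.appLE V U hUV).hom a) a' y⟩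
  have hbase := isBaseChange_unitSectionLE b (kernel ψW) hUV hV hU hK
  induction s using hbase.inductionOn with
  | zero => rw [map_zero]
  | smul a s hs => rw [Scheme.Modules.Hom.app_smul, hs, smul_zero]
  | add s₁ s₂ hs₁ hs₂ => rw [map_add, hs₁, hs₂, add_zero]
  | tmul s' =>
    rw [unitSectionLEₗ_apply, pullback_map_app_unitSectionLE, Scheme.Modules.Hom.comp_app, CategoryTheory.comp_apply]
    -- `σ := ι(s')`, a section of `𝒪_T^{(J)}` over `V` killed by `ψ_W`, in coordinates `σ = Σ_w c_w ε_w|_V`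
    have h0 : ψW.app V ((kernel.ι ψW).app V s') = 0 := app_kernel_ι_app ψW V s'
    apply hinj U
    rw [map_zero]
    -- `Z`-side: the base-change composite sends `η_b(ψ_Z(σ))|_U` to `Σ_w c_w • μ_w|_{Z'_U}`
    have key := baseChange_app_sum_smul_unitSectionLE_of_sq
      (i ≫ pullback.snd (terminal.from T) (terminal.from (Morphisms.projectiveSpaceInt ι))) _ HZ.w m ψZ hψZ Φ hΦ hUV
      fun w => b.appLE V U hUV (coord (freeModuleFrame T _ V) (𝟙 V) ((kernel.ι ψW).app V s') w)
    rw [← unitSectionLE_sum_smul, ← eq_sum_coord_smul_freeSectionOn ((kernel.ι ψW).app V s'), Scheme.Modules.Hom.comp_app,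
      CategoryTheory.comp_apply, pullback_map_app_unitSectionLE] at key
    rw [key]
    -- `W`-side: along the commuting square `Z' → W' → W`, `η_b(ψ_W(σ))|_U = 0` goes to the same combination
    have keyW := baseChange_app_sum_smul_unitSectionLE_of_sq
      (iW ≫ pullback.snd (terminal.from T) (terminal.from (Morphisms.projectiveSpaceInt ι))) _ hwW m ψW hψW ΦW hΦW hUV
      fun w => b.appLE V U hUV (coord (freeModuleFrame T _ V) (𝟙 V) ((kernel.ι ψW).app V s') w)
    rw [← unitSectionLE_sum_smul, ← eq_sum_coord_smul_freeSectionOn ((kernel.ι ψW).app V s'), Scheme.Modules.Hom.comp_app,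
      CategoryTheory.comp_apply, pullback_map_app_unitSectionLE, h0, unitSectionLE_zero, map_zero] at keyW
    exact keyW.symm

end Vanish

end Literature.AlgebraicGeometry.Motives

end
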